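import Mathlib
import Summits.NavierStokesRegularity.NavierStokesRegularity.Theorems.EulerZoomLiouvillePowerGaugeEulerLiouvilleAxisymNoSwirlTransport
import Literature.Analysis.FluidPDE.AxisymHouLiVariables
import Literature.Analysis.FluidPDE.ClassicalSolutionCalculus
import Literature.Analysis.FluidPDE.ClassicalSolutionGlue
import Literature.Analysis.FluidPDE.EnergyToolkit
import Literature.Analysis.FluidPDE.MildSolutionProofs
import Literature.Analysis.FluidPDE.WholeSpaceIBP
import Literature.Analysis.FluidPDE.AxisymmetricEuler
import HarnessLib

/-!
# Crux `EulerZoomLiouville.PowerGaugeEulerLiouville` (stmt-NavierStokesRegularity-19832), line `mirror-moment`, stub M1 — time side, part 1: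
# TRANSPORT OF `ω_θ/r` TESTED AGAINST COMPACTLY SUPPORTED WEIGHTS, AND THE CUT-OFF BALANCE OF THE AXIAL MOMENT

Route №10 `EulerZoomLiouville` (NavierStokesRegularity), crux E.  Line `mirror-moment` (ideator ns-idea-11 g3;
`Cruxes/PowerGaugeEulerLiouville/Lines/mirror_moment.lean`), registered stub `stub_momentMonotone` (M1, THE LEVER: the axial ledger moment
`M(τ) = ∫ |x₃| η(τ,x) dx`, `η = |curl u|/r`, of a classical mirror-outgoing swirl-free member is non-decreasing in `τ < 0`).
Seat ns-sfl-p1 g3 (LEAD ns-typeII-p2 g10 KEY 2026-08-28 09:38Z).  For a classical swirl-free axisymmetric Euler flow `v` on `[0, T]` with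
`Ω = angVortQuot (v ·) = ω_θ/r` (the tree's smooth radial quotient, `∂ₜΩ = −DΩ[v]`: `AxisymNoSwirl.timeDerivWithin_angVortQuot_eq_neg`):

* `integral_Ioo_integral_mul_timeDerivWithin` — `∫ₛᵗ∫ φ ∂ₜW = ∫φW(t) − ∫φW(s)` for a jointly smooth scalar family `W` and a continuous
  compactly supported weight `φ` (the linear twin of the tree's `IsSmoothSpaceTimeOn.integral_Ioo_integral_mul_timeDerivWithin_mul`);
* `integral_weight_mul_timeDerivWithin_angVortQuot` — `∫ θ ∂ₜΩ(σ) = ∫ Ω(σ) Dθ[v(σ)]` for `θ ∈ C¹_c` (transport + whole-space integration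
  by parts with `div v = 0`, `integral_mul_divergence_add_eq_zero_left`);
* `axialMoment_balance_cutoff` — with `θ = χ_R · x₃` (`χ_R = cutoff R`):
  `∫ χ_R x₃ Ω(t) − ∫ χ_R x₃ Ω(s) = ∫ₛᵗ ∫ Ω (χ_R v₃ + x₃ Dχ_R[v]) dx dτ`.

Part 2 (`…MirrorMomentMonotone`) lets `R → ∞` and assembles the monotonicity on `(−∞, 0)`.
WHAT THIS IS NOT: not NS, not the crux E — helper `--supports` stmt-19832 for ONE stratum lemma; 19832 OPEN.
[cite: MajdaBertozziCUP2002, §2.3.3 (2.58)–(2.59) (`D/Dt (ω_θ/r) = 0`)]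
-/

noncomputable section

-- flat `Theorems/<Route><Decl>…` files of one crux share the namespace of the crux (tree convention)
set_option linter.dupNamespace false

open MeasureTheory Set Filter Topology Metric Function
open scoped NNReal ENNReal RealInnerProductSpace

namespace Summit.NavierStokesRegularity.NavierStokesRegularity.Theorems.PowerGaugeEulerLiouville.MirrorMoment

open Literature.Analysis Literature.Analysis.FluidPDE
open Summit.NavierStokesRegularity.NavierStokesRegularity.Theorems.PowerGaugeEulerLiouville.AxisymNoSwirl

/-! ### Time integration of a linear localised functional -/

/-- **Time integration of `∫ φ ∂ₜW`.**  For a scalar family `W` jointly smooth on `[0, T] × ℝ³`, a continuous compactly supported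
weight `φ` and `0 ≤ s ≤ t ≤ T`: `∫ₛᵗ ∫ φ(x) ∂ₜW(τ,x) dx dτ = ∫ φ W(t) − ∫ φ W(s)` (Fubini on `(s,t) × ℝ³`, FTC on each time line).
[folklore] -/
theorem integral_Ioo_integral_mul_timeDerivWithin {T : ℝ}
    {W : ℝ → EuclideanSpace ℝ (Fin 3) → ℝ} (hW : IsSmoothSpaceTimeOn (Icc 0 T) W) (hT : 0 < T)
    {φ : EuclideanSpace ℝ (Fin 3) → ℝ} (hφ : Continuous φ) (hc : HasCompactSupport φ) {s t : ℝ} (hs : 0 ≤ s) (hst : s ≤ t)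
    (ht : t ≤ T) :
    ∫ τ in Ioo s t, ∫ x, φ x * FluidPDE.timeDerivWithin (Icc 0 T) W τ x =
      (∫ x, φ x * W t x) - ∫ x, φ x * W s x := by
  have hU : UniqueDiffOn ℝ (Icc 0 T) := uniqueDiffOn_Icc hT
  have hu_cont : ContinuousOn (uncurry W) (Icc 0 T ×ˢ univ) := hW.continuousOn
  have hdt_cont : ContinuousOn (uncurry (FluidPDE.timeDerivWithin (Icc 0 T) W)) (Icc 0 T ×ˢ univ) :=
    (hW.timeDerivWithin hU).continuousOn
  have hsub : Icc s t ×ˢ (univ : Set (EuclideanSpace ℝ (Fin 3))) ⊆ Icc 0 T ×ˢ univ :=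
    prod_mono (Icc_subset_Icc hs ht) Subset.rfl
  have hKφ : ∀ x ∉ tsupport φ, φ x = 0 := fun x hx => image_eq_zero_of_notMem_tsupport hx
  set D : ℝ × EuclideanSpace ℝ (Fin 3) → ℝ := fun z => φ z.2 * FluidPDE.timeDerivWithin (Icc 0 T) W z.1 z.2 with hD
  have hDcont : ContinuousOn D (Icc s t ×ˢ univ) :=
    (hφ.comp continuous_snd).continuousOn.mul (hdt_cont.mono hsub)
  have hDK : ∀ τ ∈ Icc s t, ∀ x ∉ tsupport φ, D (τ, x) = 0 := fun τ _ x hx => by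
    simp [hD, hKφ x hx]
  have hDint := integrable_prod_of_continuousOn hc hDcont hDK
  have hswap := integral_integral_swap (f := fun τ x => D (τ, x)) hDint
  simp only [hD] at hswap
  rw [hswap]
  have hslice : ∀ {r : ℝ}, r ∈ Icc 0 T → Integrable (fun x => φ x * W r x) (volume : Measure (EuclideanSpace ℝ (Fin 3))) :=
    fun hr => (hφ.mul (hW.contDiff_slice hr).continuous).integrable_of_hasCompactSupport hc.mul_right
  have htI : t ∈ Icc 0 T := ⟨hs.trans hst, ht⟩
  have hsI : s ∈ Icc 0 T := ⟨hs, hst.trans ht⟩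
  have hline : ∀ x, ∫ τ in Ioo s t, φ x * FluidPDE.timeDerivWithin (Icc 0 T) W τ x = φ x * W t x - φ x * W s x := by
    intro x
    rcases eq_or_lt_of_le hst with rfl | hst'
    · simp
    have hcont : ContinuousOn (fun τ => φ x * W τ x) (Icc s t) := by
      refine continuousOn_const.mul ?_
      exact hu_cont.comp (Continuous.prodMk_left x).continuousOn
        fun τ hτ => mk_mem_prod (Icc_subset_Icc hs ht hτ) (mem_univ x)
    have hderiv : ∀ τ ∈ Ioo s t, HasDerivWithinAt (fun τ => φ x * W τ x)
        (φ x * FluidPDE.timeDerivWithin (Icc 0 T) W τ x) (Ioi τ) τ := by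
      intro τ hτ
      have hτ0 : τ ∈ Ioo 0 T := ⟨hs.trans_lt hτ.1, hτ.2.trans_le ht⟩
      have hu' : HasDerivAt (fun σ => W σ x) (FluidPDE.timeDerivWithin (Icc 0 T) W τ x) τ :=
        (hW.hasDerivWithinAt_timeDerivWithin hU (Ioo_subset_Icc_self hτ0) x).hasDerivAt (Icc_mem_nhds hτ0.1 hτ0.2)
      exact (hu'.const_mul (φ x)).hasDerivWithinAt
    have hint : IntervalIntegrable (fun τ => φ x * FluidPDE.timeDerivWithin (Icc 0 T) W τ x) volume s t := by
      refine ContinuousOn.intervalIntegrable ?_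
      rw [uIcc_of_le hst]
      exact hDcont.comp (Continuous.prodMk_left x).continuousOn fun τ hτ => mk_mem_prod hτ (mem_univ x)
    have := intervalIntegral.integral_eq_sub_of_hasDeriv_right_of_le hst hcont hderiv hint
    rw [intervalIntegral.integral_of_le hst, integral_Ioc_eq_integral_Ioo] at this
    rw [this]
  rw [integral_congr_ae (Eventually.of_forall hline), integral_sub (hslice htI) (hslice hsI)]

/-! ### The slice identity `∫ θ ∂ₜΩ = ∫ Ω Dθ[v]` -/

/-- **Transport tested against a compactly supported weight.**  For a classical swirl-free axisymmetric Euler flow on `[0, T]`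
(`T > 0`), `Ω = angVortQuot (v ·)`, a time `σ ∈ [0, T]` and a weight `θ ∈ C¹_c(ℝ³)`:
`∫ θ ∂ₜΩ(σ) dx = ∫ Ω(σ,x) Dθ(x)[v(σ,x)] dx` (`∂ₜΩ = −DΩ[v]` and `∫ ⟪v, ∇(θΩ)⟫ = −∫ θΩ div v = 0`).
[cite: MajdaBertozziCUP2002, §2.3.3 (2.58)] -/
theorem integral_weight_mul_timeDerivWithin_angVortQuot {T : ℝ} (hT : 0 < T)
    {v : ℝ → EuclideanSpace ℝ (Fin 3) → EuclideanSpace ℝ (Fin 3)} {q : ℝ → EuclideanSpace ℝ (Fin 3) → ℝ}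
    (hv : IsClassicalNSSolutionOn (Icc 0 T) 0 0 v q)
    (hax : ∀ σ ∈ Icc 0 T, IsAxisymmetric (v σ)) (hsw : ∀ σ ∈ Icc 0 T, HasNoSwirl (v σ))
    {σ : ℝ} (hσ : σ ∈ Icc 0 T) {θ : EuclideanSpace ℝ (Fin 3) → ℝ} (hθ : ContDiff ℝ 1 θ) (hθc : HasCompactSupport θ) :
    ∫ x, θ x * FluidPDE.timeDerivWithin (Icc 0 T) (fun s => angVortQuot (v s)) σ x =
      ∫ x, angVortQuot (v σ) x * fderiv ℝ θ x (v σ x) := by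
  set W : EuclideanSpace ℝ (Fin 3) → ℝ := angVortQuot (v σ) with hWdef
  have hvs := hv.contDiff_velocity hσ
  have hv1 : ContDiff ℝ 1 (v σ) := hvs.of_le (by norm_cast)
  have hv4 : ContDiff ℝ 4 (v σ) := hvs.of_le (by norm_cast)
  have hW1 : ContDiff ℝ 1 W := contDiff_angVortQuot (n := 1) hv4
  -- pointwise transport
  have hpt : ∀ x, θ x * FluidPDE.timeDerivWithin (Icc 0 T) (fun s => angVortQuot (v s)) σ x =
      -(θ x * fderiv ℝ W x (v σ x)) := by
    intro x
    rw [timeDerivWithin_angVortQuot_eq_neg hT hv hax hsw hσ x]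
    ring
  simp_rw [hpt, integral_neg]
  -- integration by parts: `∫ ⟪v, ∇(θ W)⟫ = -∫ θ W div v = 0`
  have hΘ : ContDiff ℝ 1 (fun x => θ x * W x) := hθ.mul hW1
  have hΘc : HasCompactSupport (fun x => θ x * W x) := hθc.mul_right
  have hibp := integral_mul_divergence_add_eq_zero_left hΘ hv1 hΘc
  have hdiv0 : ∀ x, VectorCalculus.divergence (v σ) x = 0 := fun x => hv.divFree σ hσ x
  simp only [hdiv0, mul_zero, integral_zero, zero_add] at hibp
  -- expand `⟪v, ∇(θW)⟫ = W Dθ[v] + θ DW[v]`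
  have hgrad : ∀ x, ⟪v σ x, gradient (fun x => θ x * W x) x⟫ = W x * fderiv ℝ θ x (v σ x) + θ x * fderiv ℝ W x (v σ x) := by
    intro x
    rw [real_inner_comm, gradient, InnerProductSpace.toDual_symm_apply,
      fderiv_fun_mul (hθ.differentiable one_ne_zero x) (hW1.differentiable one_ne_zero x)]
    simp only [FunLike.coe_add, FunLike.coe_smul, Pi.add_apply, Pi.smul_apply, smul_eq_mul]
    ring
  simp_rw [hgrad] at hibp
  have hi1 : Integrable fun x => W x * fderiv ℝ θ x (v σ x) := by
    refine (hW1.continuous.mul ((hθ.continuous_fderiv one_ne_zero).clm_apply hv1.continuous)).integrable_of_hasCompactSupport ?_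
    refine (hθc.fderiv (𝕜 := ℝ)).mono' fun x hx => ?_
    contrapose! hx
    simp [image_eq_zero_of_notMem_tsupport hx]
  have hi2 : Integrable fun x => θ x * fderiv ℝ W x (v σ x) :=
    (hθ.continuous.mul ((hW1.continuous_fderiv one_ne_zero).clm_apply hv1.continuous)).integrable_of_hasCompactSupport
      hθc.mul_right
  rw [integral_add hi1 hi2] at hibp
  linarith


/-! ### The cut-off balance of the axial functional -/

/-- The axial coordinate `x ↦ x₃` of `ℝ³` (index `2`) is the continuous linear map `EuclideanSpace.proj 2`; its derivative
acts as `w ↦ w₃`. [folklore] -/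
theorem hasFDerivAt_coord_two (x : EuclideanSpace ℝ (Fin 3)) :
    HasFDerivAt (fun y : EuclideanSpace ℝ (Fin 3) => y 2) (EuclideanSpace.proj (𝕜 := ℝ) (2 : Fin 3)) x :=
  (EuclideanSpace.proj (𝕜 := ℝ) (2 : Fin 3)).hasFDerivAt

/-- **The cut-off balance.**  For a classical swirl-free axisymmetric Euler flow on `[0, T]`, `0 ≤ s ≤ t ≤ T` and `R > 0`, with
`χ_R = cutoff R` and `Ω = angVortQuot (v ·)`:
`∫ χ_R x₃ Ω(t) − ∫ χ_R x₃ Ω(s) = ∫ₛᵗ ∫ Ω(τ,x) (χ_R(x) v₃(τ,x) + x₃ Dχ_R(x)[v(τ,x)]) dx dτ`. [cite: MajdaBertozziCUP2002, §2.3.3 (2.58)] -/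
theorem axialMoment_balance_cutoff {T : ℝ} (hT : 0 < T)
    {v : ℝ → EuclideanSpace ℝ (Fin 3) → EuclideanSpace ℝ (Fin 3)} {q : ℝ → EuclideanSpace ℝ (Fin 3) → ℝ}
    (hv : IsClassicalNSSolutionOn (Icc 0 T) 0 0 v q)
    (hax : ∀ σ ∈ Icc 0 T, IsAxisymmetric (v σ)) (hsw : ∀ σ ∈ Icc 0 T, HasNoSwirl (v σ))
    {s t : ℝ} (hs : 0 ≤ s) (hst : s ≤ t) (ht : t ≤ T) {R : ℝ} (hR : 0 < R) :
    (∫ x, cutoff R x * x 2 * angVortQuot (v t) x) - ∫ x, cutoff R x * x 2 * angVortQuot (v s) x =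
      ∫ τ in Ioo s t, ∫ x, angVortQuot (v τ) x * (cutoff R x * v τ x 2 + x 2 * fderiv ℝ (cutoff R) x (v τ x)) := by
  have hU : UniqueDiffOn ℝ (Icc 0 T) := uniqueDiffOn_Icc hT
  have hWfam : IsSmoothSpaceTimeOn (Icc 0 T) (fun σ => angVortQuot (v σ)) :=
    hv.smooth_velocity.angVortQuot_family (convex_Icc 0 T) hU
  have hχ : ContDiff ℝ 1 (cutoff (E := EuclideanSpace ℝ (Fin 3)) R) := contDiff_cutoff R
  have hχc : HasCompactSupport (cutoff (E := EuclideanSpace ℝ (Fin 3)) R) := hasCompactSupport_cutoff hR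
  have hcoord : ContDiff ℝ 1 (fun y : EuclideanSpace ℝ (Fin 3) => y 2) := (EuclideanSpace.proj (𝕜 := ℝ) (2 : Fin 3)).contDiff
  set φ : EuclideanSpace ℝ (Fin 3) → ℝ := fun x => cutoff R x * x 2 with hφdef
  have hφ1 : ContDiff ℝ 1 φ := hχ.mul hcoord
  have hφc : HasCompactSupport φ := hχc.mul_right
  have h1 := integral_Ioo_integral_mul_timeDerivWithin hWfam hT hφ1.continuous hφc hs hst ht
  have e1 : (∫ x, cutoff R x * x 2 * angVortQuot (v t) x) - ∫ x, cutoff R x * x 2 * angVortQuot (v s) x =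
      (∫ x, φ x * angVortQuot (v t) x) - ∫ x, φ x * angVortQuot (v s) x := by rfl
  rw [e1, ← h1]
  refine setIntegral_congr_fun measurableSet_Ioo fun τ hτ => ?_
  have hτ' : τ ∈ Icc 0 T := ⟨hs.trans hτ.1.le, hτ.2.le.trans ht⟩
  rw [integral_weight_mul_timeDerivWithin_angVortQuot hT hv hax hsw hτ' hφ1 hφc]
  refine integral_congr_ae (Eventually.of_forall fun x => ?_)
  have hd : HasFDerivAt φ (cutoff R x • EuclideanSpace.proj (𝕜 := ℝ) (2 : Fin 3) + (x 2) • fderiv ℝ (cutoff R) x) x :=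
    ((hχ.differentiable one_ne_zero x).hasFDerivAt).mul (hasFDerivAt_coord_two x)
  show angVortQuot (v τ) x * fderiv ℝ φ x (v τ x) = angVortQuot (v τ) x * (cutoff R x * v τ x 2 + x 2 * fderiv ℝ (cutoff R) x (v τ x))
  rw [hd.fderiv]
  simp only [FunLike.coe_add, FunLike.coe_smul, Pi.add_apply, Pi.smul_apply, smul_eq_mul]
  rfl

end Summit.NavierStokesRegularity.NavierStokesRegularity.Theorems.PowerGaugeEulerLiouville.MirrorMoment

end
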